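import Summits.Ventures.LatticeQCDFlow.Scaling.HubClassStartContentResidualGEnum
import Summits.Ventures.LatticeQCDFlow.Scaling.TaggedStartContentDeficitSharp

/-!
HONEST FRAMING: exact (Metropolis-corrected) sampling algorithms for lattice gauge theory; figures
of merit are autocorrelation/cost numbers at stated couplings and volumes; no continuum-physics
claim.

# TaggedStartContentResidualG — THE SIGNED `g`-FORM OF THE RESIDUAL PAIR'S START-CONTENT DEFICIT FOR W26'S TAGGED CHAINS: `y_n(z) − x_n(z) ≤ K^{−n}(g_n(W_z/W_b) − g_n(W_z/W_a))`,
# `g_n(u) = (−u − (−u)^{n+1})/(1+u)` (lean-2 GEN-42, ours)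

Venture-side (OURS).  Cell `lqcd-flow` (pub-lqcd), unit `pub-lqcd-lean-2-g42`, 2026-08-30.  Chapter AB (route (β), the cost side continued), file 15 = file 14 moved to the tagged hub
chains exactly as GEN-41 file 6 (B) moved GEN-41 file 5 (B) (chapter W's data on `Option S`, Z4 `tagged_kernel_eq`, a common enumeration sorted by the key `W^X + W^Y`, the ranks
`s = 0`, `i = 1` read off the strict inequalities).  Configuration (B): `N_C(z) = 1`, `W_z ≤ W_b ≤ W_a`, `W_z < W_a`, every other present content strictly below `W_z`, no present content
strictly between `W_b` and `W_a` (automatic here).  At odd `n` the bound is NEGATIVE (`−K^{−n}(1−α^{n+1})/(1+α)` when `W_b = W_z`): the input the lone-hub-between configuration needs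
(memo MEMO-gen42 §5), typed here as a tool; GEN-41 file 6 (B)'s integrated forms follow from it but are not re-derived.

* **`tagged_startClass_residual_g`**: `y_n(z) − x_n(z) ≤ (1/K)ⁿ·(g_n(W_z/W_b) − g_n(W_z/W_a))` for every `n`.

Literature grade (cell rule): OWN, plumbing; nothing cited; no new bib keys.
-/

open Finset

namespace Summit.Ventures.LatticeQCDFlow.Scaling

section ResidualG
variable {S : Type*} [Fintype S] [DecidableEq S]
variable {W : S → ℝ} {acc : S → S → ℝ} {K : ℕ} {NC : S → ℕ} {a b : S} {PX PY : Option S → Option S → ℝ}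

/-- **The signed `g`-form of the residual pair's start-content deficit, tagged chains** (see the module docstring). [ours] -/
theorem tagged_startClass_residual_g (hW : ∀ v, 0 < W v) (hacc : ∀ h v, acc h v = min 1 (W h / W v)) (hK : 2 ≤ K) (hNC : ∑ v, NC v = K) (hab : W b ≤ W a)
    (hPXoff : ∀ h v, h ≠ v → PX (some h) (some v) = if NC h = 0 then 0 else (NC v : ℝ) / K * acc h v)
    (hPXin : ∀ h, PX (some h) none = if NC h = 0 then 0 else acc h a / K)
    (hPXdiag : ∀ h, PX (some h) (some h) = 1 - (∑ v ∈ univ.erase h, PX (some h) (some v) + PX (some h) none))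
    (hPXout : ∀ v, PX none (some v) = (NC v : ℝ) / K * acc a v) (hPXstay : PX none none = 1 - ∑ v, PX none (some v))
    (hPYoff : ∀ h v, h ≠ v → PY (some h) (some v) = if NC h = 0 then 0 else (NC v : ℝ) / K * acc h v)
    (hPYin : ∀ h, PY (some h) none = if NC h = 0 then 0 else acc h b / K)
    (hPYdiag : ∀ h, PY (some h) (some h) = 1 - (∑ v ∈ univ.erase h, PY (some h) (some v) + PY (some h) none))
    (hPYout : ∀ v, PY none (some v) = (NC v : ℝ) / K * acc b v) (hPYstay : PY none none = 1 - ∑ v, PY none (some v))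
    {z : S} (hz1 : NC z = 1) (hzb : W z ≤ W b) (hza : W z < W a) (hbelow : ∀ w, w ≠ z → NC w ≠ 0 → W w < W z)
    {x y : ℕ → Option S → ℝ}
    (hx0 : ∀ v, x 0 v = if v = some z then 1 else 0) (hxs : ∀ n v, x (n + 1) v = ∑ h, x n h * PX h v)
    (hy0 : ∀ v, y 0 v = if v = some z then 1 else 0) (hys : ∀ n v, y (n + 1) v = ∑ h, y n h * PY h v) (n : ℕ) :
    y n (some z) - x n (some z)
      ≤ (1 / (K : ℝ)) ^ n * (((-(W z / W b) - (-(W z / W b)) ^ (n + 1)) / (1 + W z / W b))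
          - ((-(W z / W a) - (-(W z / W a)) ^ (n + 1)) / (1 + W z / W a))) := by
  have hz : NC z ≠ 0 := by rw [hz1]; exact one_ne_zero
  -- a residual pair is depth-adjacent
  have hnone : ∀ w, NC w ≠ 0 → ¬ (W b < W w ∧ W w < W a) := by
    intro w hw hbw
    by_cases hwz : w = z
    · rw [hwz] at hbw; linarith [hbw.1]
    · linarith [hbelow w hwz hw, hbw.1]
  classical
  -- chapter W's data on the content type `Option S` (verbatim from Z12 ∕ GEN-41 file 6)
  obtain ⟨N', hN'⟩ : ∃ N' : Option S → ℕ, ∀ o, N' o = Option.elim o 1 NC := ⟨_, fun _ => rfl⟩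
  obtain ⟨WX', hWX'⟩ : ∃ W' : Option S → ℝ, ∀ o, W' o = Option.elim o (W a) W := ⟨_, fun _ => rfl⟩
  obtain ⟨WY', hWY'⟩ : ∃ W' : Option S → ℝ, ∀ o, W' o = Option.elim o (W b) W := ⟨_, fun _ => rfl⟩
  obtain ⟨accX', haccX'⟩ : ∃ acc' : Option S → Option S → ℝ, ∀ h v, acc' h v = min 1 (WX' h / WX' v) := ⟨_, fun _ _ => rfl⟩
  obtain ⟨accY', haccY'⟩ : ∃ acc' : Option S → Option S → ℝ, ∀ h v, acc' h v = min 1 (WY' h / WY' v) := ⟨_, fun _ _ => rfl⟩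
  obtain ⟨offX, hoffX⟩ : ∃ off : (Option S → ℕ) → Option S → Option S → ℝ, ∀ M h v, off M h v = if M h = 0 then 0 else (M v : ℝ) / K * accX' h v :=
    ⟨_, fun _ _ _ => rfl⟩
  obtain ⟨offY, hoffY⟩ : ∃ off : (Option S → ℕ) → Option S → Option S → ℝ, ∀ M h v, off M h v = if M h = 0 then 0 else (M v : ℝ) / K * accY' h v :=
    ⟨_, fun _ _ _ => rfl⟩
  obtain ⟨KhX, hKhX⟩ : ∃ Kh : (Option S → ℕ) → Option S → Option S → ℝ, ∀ M h v, Kh M h v = if h = v then 1 - ∑ v' ∈ univ.erase h, offX M h v' else offX M h v :=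
    ⟨_, fun _ _ _ => rfl⟩
  obtain ⟨KhY, hKhY⟩ : ∃ Kh : (Option S → ℕ) → Option S → Option S → ℝ, ∀ M h v, Kh M h v = if h = v then 1 - ∑ v' ∈ univ.erase h, offY M h v' else offY M h v :=
    ⟨_, fun _ _ _ => rfl⟩
  have hKXoff : ∀ M h v, h ≠ v → KhX M h v = if M h = 0 then 0 else (M v : ℝ) / K * min 1 (WX' h / WX' v) := fun M h v hhv => by
    rw [hKhX, if_neg hhv, hoffX, haccX']
  have hKYoff : ∀ M h v, h ≠ v → KhY M h v = if M h = 0 then 0 else (M v : ℝ) / K * min 1 (WY' h / WY' v) := fun M h v hhv => by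
    rw [hKhY, if_neg hhv, hoffY, haccY']
  have hKXoff' : ∀ M h v, h ≠ v → KhX M h v = if M h = 0 then 0 else (M v : ℝ) / K * accX' h v := fun M h v hhv => by rw [hKXoff M h v hhv, haccX']
  have hKYoff' : ∀ M h v, h ≠ v → KhY M h v = if M h = 0 then 0 else (M v : ℝ) / K * accY' h v := fun M h v hhv => by rw [hKYoff M h v hhv, haccY']
  have hKXdiag : ∀ M h, KhX M h h = 1 - ∑ v ∈ univ.erase h, KhX M h v := fun M h => by
    rw [hKhX, if_pos rfl]; congr 1; exact sum_congr rfl fun v hv => by rw [hKhX, if_neg (ne_of_mem_erase hv).symm]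
  have hKYdiag : ∀ M h, KhY M h h = 1 - ∑ v ∈ univ.erase h, KhY M h v := fun M h => by
    rw [hKhY, if_pos rfl]; congr 1; exact sum_congr rfl fun v hv => by rw [hKhY, if_neg (ne_of_mem_erase hv).symm]
  have hPX : ∀ h v, PX h v = KhX N' h v := tagged_kernel_eq hacc hPXoff hPXin hPXdiag hPXout hPXstay hN' hWX' hKXoff hKXdiag
  have hPY : ∀ h v, PY h v = KhY N' h v := tagged_kernel_eq hacc hPYoff hPYin hPYdiag hPYout hPYstay hN' hWY' hKYoff hKYdiag
  let KhnX : ℕ → Option S → Option S → ℝ := fun n =>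
    Nat.rec (motive := fun _ => Option S → Option S → ℝ) (fun h v => if h = v then 1 else 0) (fun _ prev h v => ∑ w', prev h w' * KhX N' w' v) n
  let KhnY : ℕ → Option S → Option S → ℝ := fun n =>
    Nat.rec (motive := fun _ => Option S → Option S → ℝ) (fun h v => if h = v then 1 else 0) (fun _ prev h v => ∑ w', prev h w' * KhY N' w' v) n
  have hKhnX0 : ∀ h v, KhnX 0 h v = if h = v then 1 else 0 := fun _ _ => rfl
  have hKhnXs : ∀ n h v, KhnX (n + 1) h v = ∑ w', KhnX n h w' * KhX N' w' v := fun _ _ _ => rfl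
  have hKhnY0 : ∀ h v, KhnY 0 h v = if h = v then 1 else 0 := fun _ _ => rfl
  have hKhnYs : ∀ n h v, KhnY (n + 1) h v = ∑ w', KhnY n h w' * KhY N' w' v := fun _ _ _ => rfl
  have hxrow : ∀ n v, x n v = KhnX n (some z) v := by
    intro n; induction n with
    | zero => intro v; rw [hx0, hKhnX0]; by_cases h : v = some z <;> simp [h, eq_comm]
    | succ n ih => intro v; rw [hxs, hKhnXs]; exact sum_congr rfl fun h _ => by rw [ih, hPX]
  have hyrow : ∀ n v, y n v = KhnY n (some z) v := by
    intro n; induction n with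
    | zero => intro v; rw [hy0, hKhnY0]; by_cases h : v = some z <;> simp [h, eq_comm]
    | succ n ih => intro v; rw [hys, hKhnYs]; exact sum_congr rfl fun h _ => by rw [ih, hPY]
  -- the hypotheses of file 4 (no betweenness proviso)
  have hWXpos : ∀ o, 0 < WX' o := fun o => by rw [hWX']; rcases o with _ | v <;> simp [hW]
  have hWYpos : ∀ o, 0 < WY' o := fun o => by rw [hWY']; rcases o with _ | v <;> simp [hW]
  have hagree : ∀ o, o ≠ none → WX' o = WY' o := fun o ho => by
    rcases o with _ | v
    · exact absurd rfl ho
    · rw [hWX', hWY']; rfl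
  have hWt : WY' none ≤ WX' none := by rw [hWX', hWY']; exact hab
  have hNK : ∑ o, (N' o : ℝ) = K + 1 := by
    have h1 : ∑ o, (N' o : ℝ) = 1 + ∑ v, (NC v : ℝ) := by rw [Fintype.sum_option]; simp [hN', Option.elim]
    have h2 : ∑ v, (NC v : ℝ) = K := by exact_mod_cast hNC
    rw [h1, h2]; ring
  have hNt : N' none = 1 := by rw [hN']; simp
  have hnone' : ∀ o, N' o ≠ 0 → o ≠ none → ¬ (WY' none < WX' o ∧ WX' o < WX' none) := by
    intro o ho hon
    rcases o with _ | w
    · exact absurd rfl hon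
    · rw [hWX', hWX', hWY']
      have hw : NC w ≠ 0 := by rw [hN'] at ho; exact ho
      exact hnone w hw
  -- a common sorted enumeration and the two ranks (verbatim from GEN-41 file 6)
  obtain ⟨m, e, he_inj, he_pres, he_cov, hkey⟩ := global_exists_sorted_enum N' (fun o => WX' o + WY' o) none
  obtain ⟨hsortX, hsortY⟩ := global_sorted_of_key hagree hWt hnone' he_inj he_pres hkey
  have hzN : N' (some z) ≠ 0 := by rw [hN']; exact hz
  have htN : N' none ≠ 0 := by rw [hNt]; exact one_ne_zero
  obtain ⟨i, hi, hiz⟩ := he_cov (some z) hzN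
  obtain ⟨s, hs, hst⟩ := he_cov none htN
  have hrank_lt : ∀ l l', l < m → l' < m → WX' (e l') < WX' (e l) → l < l' := by
    intro l l' hl hl' hlt
    by_contra hge
    exact absurd (hsortX l' l (by omega) hl) (not_le.mpr hlt)
  have hrank_key : ∀ l l', l < m → l' < m → WX' (e l') + WY' (e l') < WX' (e l) + WY' (e l) → l < l' := by
    intro l l' hl hl' hlt
    by_contra hge
    exact absurd (hkey l' l (by omega) hl) (not_le.mpr hlt)
  have hsi : s < i := hrank_key s i hs hi (by rw [hiz, hst, hWX', hWX', hWY', hWY']; simp only [Option.elim]; linarith)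
  have hWz : WX' (e i) = W z := by rw [hiz, hWX']; rfl
  have hothers : ∀ l, l < m → l ≠ s → l ≠ i → i < l := by
    intro l hl hls hli
    have hpres := he_pres l hl
    obtain ⟨w, hw⟩ : ∃ w, e l = some w := by
      rcases h : e l with _ | w
      · exact absurd (he_inj l s hl hs (by rw [h, hst])) hls
      · exact ⟨w, rfl⟩
    have hwz : w ≠ z := fun h => hli (he_inj l i hl hi (by rw [hw, hiz, h]))
    have hNw : NC w ≠ 0 := by rw [hw, hN'] at hpres; exact hpres
    exact hrank_lt i l hi hl (by rw [hWz, hw, hWX']; exact hbelow w hwz hNw)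
  have hs0 : s = 0 := by
    by_contra h
    have h0 : (0 : ℕ) < m := by omega
    rcases Nat.eq_or_lt_of_le (Nat.zero_le i) with hi0 | hi0
    · exact absurd hi0.symm (by omega)
    · have := hothers 0 h0 (Ne.symm h) (by omega); omega
  have hi1 : i = 1 := by
    by_contra h
    have h1 : (1 : ℕ) < m := by omega
    have := hothers 1 h1 (by omega) (Ne.symm h); omega
  have h := hubClass_startClass_residual_g_of_enum hWXpos hWYpos hagree hWt haccX' haccY' hK hNK hNt hKXoff' hKXdiag hKYoff' hKYdiag hKhnX0 hKhnXs hKhnY0 hKhnYs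
    he_inj he_pres he_cov hsortX hsortY hi hs hiz hst hsi hs0 hi1 (by rw [hN']; exact hz1) n
  have hWt' : WX' none = W a := by rw [hWX']; rfl
  have hWb' : WY' none = W b := by rw [hWY']; rfl
  have hWz' : WX' (some z) = W z := by rw [hWX']; rfl
  rw [hWt', hWb', hWz'] at h
  rw [hxrow, hyrow]; exact h

end ResidualG

end Summit.Ventures.LatticeQCDFlow.Scaling
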